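import Literature.NumberTheory.Automorphic.OrbitalIntegralLocallyConstantChart
import Literature.NumberTheory.Automorphic.CompactCoreLevelPoint
import Literature.LinearAlgebra.Matrix.CharpolyLocalRigidity
import HarnessLib

/-!
# Regular orbital integrals are locally constant in chart coordinates, II: chart data on a topological group, and the `GL_n` ∕ closed-subgroup
# dress (Weyl separation ⇒ chart saturation)

Topic `NumberTheory/Automorphic`; namespace `Literature.NumberTheory.Automorphic`. THEOREMS ONLY (no definition, no instance, no notation, no named
fact, no `sorry`). Cell `pub/hodgecm-mathlib`, programme P3a, road «N6-ns», brick **N6ns-reg-(ii)** (LEAD T8-2 (3), T8-7 (B)), the DRESS layer over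
★ `OrbitalIntegralLocallyConstantChart` (generic pointwise layer) and ★ `CharpolyLocalRigidity` (Weyl separation).

A CHART DATUM on a topological group `G` around a torus point `γ = τ b₀`: continuous maps `s : A → G` («slice», e.g. the Cayley map on `𝔲 ∩ 𝔪`)
and `τ : B → G` («torus coordinate», e.g. `Y ↦ γ c(Y)` on `𝔲 ∩ 𝔠`), a compact `K ⊆ A`, a box `B₀ ⊆ B`, and the chart map
`Φ(a, b) = s(a) τ(b) s(a)⁻¹`. Hypotheses on the box: (reg) `τ b` is a `P`-point with `Z(τ b) = Z(τ b₀)` for `b ∈ B₀`; (wsep) WEYL SEPARATION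
`y τ(b) y⁻¹ = τ(b′)` (`b, b′ ∈ B₀`) `⇒ y ∈ Z(τ b)`. Then:
* §1 `mem_mul_of_conj_mem_image_chart` — (wsep) ⇒ the chart SATURATION `x τ(b) x⁻¹ ∈ Φ(K × B₀) ⇒ x ∈ s(K)·T` (hypothesis (SAT) of the generic layer);
  `OrbitalMeasureFamily.IsCanonical.exists_nhds_classOrbitalIntegral_mk_eq_of_chart` — for a canonical family `m` and a LOCALLY CONSTANT `f` supported in
  `Φ(K × B₀)`: `Φ([τ b], f; m) = Φ([τ b₀], f; m)` for `b ∈ B₀` near `b₀` (tube lemma ★ `exists_nhds_forall_comp_eq_of_isLocallyConstant` on the compact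
  `K` + ★ `classOrbitalIntegral_mk_eq_of_forall_conj_eq`; the core-normalised Haar measure on `T` comes from `m` itself, ★ `IsCanonical.atPoint_eq_quotientMeasure`).
* §2 the `GL_n` ∕ CLOSED-SUBGROUP dress (`U ≤ GL_n(E)`, `E` a topological field): (reg) from SEPARABILITY — `centralizer_eq_centralizer_of_charpoly_separable`
  (`t ∈ Z(γ)` with `χ_t`, `χ_γ` separable ⇒ `Z_U(t) = Z_U(γ)`, both centralisers being abelian ★ `commute_of_commute_of_charpoly_separable`); (wsep) on a
  small box from ★ `eventually_mem_centralizer_of_conj_eq` — `exists_nhds_forall_conj_eq_imp_mem_centralizer`; and the assembled head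
  `exists_nhds_classOrbitalIntegral_mk_eq_of_subgroup_chart`.
NOT here: the Cayley chart of `U(J)` itself (A-p16 chart-3 `exists_openPartialHomeomorphism_conjOrbit_isImage_unitary` supplies `s`, `τ`, injectivity and
the relative openness of `Φ(K × B₀)`), Harish-Chandra's uniform compactness for `f` not supported in a chart image ((ii′)), the glue (iii).

## References
* [HarishChandra1970] Harish-Chandra (notes by G. van Dijk), *Harmonic Analysis on Reductive p-adic Groups*, LNM 162 (1970), Part I §3.
* [Rogawski1990] J. D. Rogawski, *Automorphic Representations of Unitary Groups in Three Variables*, Ann. of Math. Stud. 123 (1990), §3.1 p. 19; §4.3 p. 43; §4.9 p. 54.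
* [DeitmarEchterhoff2014] A. Deitmar, S. Echterhoff, *Principles of Harmonic Analysis*, 2nd ed. (2014), Thm. 1.5.3.
-/

set_option autoImplicit false

noncomputable section

open MeasureTheory Measure Set Filter Topology Literature.MeasureTheory.Group
open scoped ENNReal NNReal Pointwise MatrixGroups

namespace Literature.NumberTheory.Automorphic

/-! ## §1 Chart data on a topological group -/

section ChartDatum

variable {G : Type*} [Group G] {A B : Type*}

/-- **Weyl separation on the box ⇒ chart saturation**: if `y τ(b) y⁻¹ = τ(b′)` (`b, b′ ∈ B₀`) forces `y ∈ Z(τ b) = T`, then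
`x τ(b) x⁻¹ ∈ Φ(K × B₀)` forces `x ∈ s(K)·T`. [cite: HarishChandra1970, Part I §3] -/
theorem mem_mul_of_conj_mem_image_chart (T : Subgroup G) (s : A → G) (τ : B → G) (K : Set A) (B₀ : Set B)
    (hT : ∀ b ∈ B₀, Subgroup.centralizer ({τ b} : Set G) = T)
    (hsep : ∀ b ∈ B₀, ∀ b' ∈ B₀, ∀ y : G, y * τ b * y⁻¹ = τ b' → y ∈ Subgroup.centralizer ({τ b} : Set G)) :
    ∀ t ∈ τ '' B₀, ∀ x : G, x * t * x⁻¹ ∈ (fun p : A × B => s p.1 * τ p.2 * (s p.1)⁻¹) '' (K ×ˢ B₀) → x ∈ (s '' K) * (T : Set G) := by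
  rintro t ⟨b, hb, rfl⟩ x ⟨⟨a', b'⟩, ⟨ha', hb'⟩, hx⟩
  have hx' : s a' * τ b' * (s a')⁻¹ = x * τ b * x⁻¹ := hx
  have hy : (s a')⁻¹ * x * τ b * ((s a')⁻¹ * x)⁻¹ = τ b' := by
    have h1 : (s a')⁻¹ * x * τ b * ((s a')⁻¹ * x)⁻¹ = (s a')⁻¹ * (x * τ b * x⁻¹) * s a' := by group
    rw [h1, ← hx']
    group
  have hyT : (s a')⁻¹ * x ∈ T := by
    rw [← hT b hb]
    exact hsep b hb b' hb' _ hy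
  exact Set.mem_mul.2 ⟨s a', ⟨a', ha', rfl⟩, (s a')⁻¹ * x, hyT, mul_inv_cancel_left _ _⟩

variable [TopologicalSpace G] [IsTopologicalGroup G] [LocallyCompactSpace G] [SecondCountableTopology G] [T2Space G]
  [MeasurableSpace G] [BorelSpace G]
  [∀ γ : G, MeasurableSpace (G ⧸ Subgroup.centralizer ({γ} : Set G))]
  [∀ γ : G, BorelSpace (G ⧸ Subgroup.centralizer ({γ} : Set G))]
  {V : Type*} [NormedAddCommGroup V] [NormedSpace ℝ V]
  [TopologicalSpace A] [TopologicalSpace B]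

/-- **N6ns-reg-(ii), CHART-DATUM FORM — Φ([τ b], f; m) = Φ([τ b₀], f; m) for `b` near `b₀`.** `m` canonical (`P` conjugation-invariant), a chart datum
`(s, τ, K, B₀)` with `s, τ` continuous, `K` compact, `b₀ ∈ B₀`, (reg) and (wsep) on the box; `f` LOCALLY CONSTANT and supported in the chart image
`Φ(K × B₀)`. (The core-normalised Haar measure on `T = Z(τ b₀)` is read off `m`; (SAT) by ★ `mem_mul_of_conj_mem_image_chart`; `f(s(a) τ(b) s(a)⁻¹) =
f(s(a) τ(b₀) s(a)⁻¹)` on `K` for `b` near `b₀` by the tube lemma.) [cite: HarishChandra1970, Part I §3] [cite: Rogawski1990, §4.3 p. 43; §4.9 p. 54] -/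
theorem OrbitalMeasureFamily.IsCanonical.exists_nhds_classOrbitalIntegral_mk_eq_of_chart
    {P : G → Prop} (hP : ∀ g x : G, P g → P (x * g * x⁻¹)) {ν : Measure G} [IsHaarMeasure ν] [ν.IsMulRightInvariant]
    {m : OrbitalMeasureFamily G} (hm : m.IsCanonical P ν)
    (s : A → G) (hs : Continuous s) (τ : B → G) (hτ : Continuous τ) {K : Set A} (hK : IsCompact K) {B₀ : Set B} {b₀ : B} (hb₀ : b₀ ∈ B₀)
    (hreg : ∀ b ∈ B₀, P (τ b) ∧ Subgroup.centralizer ({τ b} : Set G) = Subgroup.centralizer ({τ b₀} : Set G))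
    (hsep : ∀ b ∈ B₀, ∀ b' ∈ B₀, ∀ y : G, y * τ b * y⁻¹ = τ b' → y ∈ Subgroup.centralizer ({τ b} : Set G))
    {f : G → V} (hf : IsLocallyConstant f)
    (hfΩ : ∀ y, f y ≠ 0 → y ∈ (fun p : A × B => s p.1 * τ p.2 * (s p.1)⁻¹) '' (K ×ˢ B₀)) :
    ∃ W ∈ 𝓝 b₀, ∀ b ∈ W, b ∈ B₀ →
      classOrbitalIntegral m f (ConjClasses.mk (τ b)) = classOrbitalIntegral m f (ConjClasses.mk (τ b₀)) := by
  -- the canonical torus measure on `T = Z(τ b₀)`, read off `m`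
  obtain ⟨ρ, hρ, hρi, hρ1, -⟩ := hm.atPoint_eq_quotientMeasure (τ b₀) (apply_out_conjClassesMk_of_forall_conj hP (hreg b₀ hb₀).1)
  haveI := hρ
  haveI := hρi
  -- the tube lemma on the compact `K`
  have hΦ : Continuous fun p : A × B => s p.1 * τ p.2 * (s p.1)⁻¹ :=
    ((hs.comp continuous_fst).mul (hτ.comp continuous_snd)).mul (hs.comp continuous_fst).inv
  obtain ⟨W, hW, hconst⟩ := exists_nhds_forall_comp_eq_of_isLocallyConstant (fun p : A × B => s p.1 * τ p.2 * (s p.1)⁻¹)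
    (hf.comp_continuous hΦ) hK b₀
  refine ⟨W, hW, fun b hbW hbB => ?_⟩
  have hsat := mem_mul_of_conj_mem_image_chart (Subgroup.centralizer ({τ b₀} : Set G)) s τ K B₀ (fun b hb => (hreg b hb).2) hsep
  exact hm.classOrbitalIntegral_mk_eq_of_forall_conj_eq hP (Subgroup.centralizer ({τ b₀} : Set G)) (isClosed_coe_centralizer_singleton _)
    ρ hρ1 (s '' K) ((fun p : A × B => s p.1 * τ p.2 * (s p.1)⁻¹) '' (K ×ˢ B₀)) (τ '' B₀)
    (by rintro t ⟨b', hb', rfl⟩; exact hreg b' hb') hsat (fun y hy => by_contra fun h => hy (hfΩ y h))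
    ⟨b, hbB, rfl⟩ ⟨b₀, hb₀, rfl⟩ (by rintro _ ⟨a, ha, rfl⟩; exact hconst a ha b hbW)

end ChartDatum

/-! ## §2 The `GL_n` ∕ closed-subgroup dress: (reg) from separability, (wsep) from Weyl separation -/

section Subgroup

variable {E : Type*} [Field E] [TopologicalSpace E] [IsTopologicalRing E] [T1Space E]
  {n : Type*} [Fintype n] [DecidableEq n] {U : Subgroup (GL n E)}

omit [TopologicalSpace E] [IsTopologicalRing E] [T1Space E] in
/-- **(reg) from separability**: in a subgroup `U ≤ GL_n(E)`, if `t ∈ Z_U(γ)` and both `χ_t`, `χ_γ` are separable then `Z_U(t) = Z_U(γ)` (both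
centralisers are abelian, ★ `commute_of_commute_of_charpoly_separable`, and each contains the other's generator). [cite: Rogawski1990, §3.1 p. 19] -/
theorem centralizer_eq_centralizer_of_charpoly_separable {γ t : ↥U}
    (hγ : ((γ : GL n E) : Matrix n n E).charpoly.Separable) (ht : ((t : GL n E) : Matrix n n E).charpoly.Separable)
    (htγ : t ∈ Subgroup.centralizer ({γ} : Set ↥U)) :
    Subgroup.centralizer ({t} : Set ↥U) = Subgroup.centralizer ({γ} : Set ↥U) := by
  have hval : ∀ {a b : ↥U}, a ∈ Subgroup.centralizer ({b} : Set ↥U) ↔ Commute ((a : GL n E) : Matrix n n E) ((b : GL n E) : Matrix n n E) :=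
    fun {a b} => by
    rw [Subgroup.mem_centralizer_singleton_iff]
    constructor
    · intro h
      have h' := congrArg (fun g : ↥U => ((g : GL n E) : Matrix n n E)) h
      simp only [Subgroup.coe_mul, Units.val_mul] at h'
      exact h'
    · intro h
      have h' : ((a * b : ↥U) : GL n E) = ((b * a : ↥U) : GL n E) := Units.ext (by simp only [Subgroup.coe_mul, Units.val_mul]; exact h)
      exact Subtype.ext h'
  have htγ' := hval.1 htγ
  ext y
  rw [hval, hval]
  exact ⟨fun h => Literature.LinearAlgebra.Matrix.commute_of_commute_of_charpoly_separable ht h htγ'.symm,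
    fun h => Literature.LinearAlgebra.Matrix.commute_of_commute_of_charpoly_separable hγ h htγ'⟩

/-- **(wsep) on a small box from the Weyl separation** ★ `eventually_mem_centralizer_of_conj_eq`: for `τ : B → U` continuous at `b₀` with
`τ b₀ = γ` regular semisimple, there is a neighbourhood `W` of `b₀` such that for `b, b′ ∈ W` with `τ b, τ b′ ∈ Z_U(γ)`:
`y τ(b) y⁻¹ = τ(b′)` (`y ∈ U`) `⇒ y ∈ Z_U(τ b)`. [cite: HarishChandra1970, Part I §3] [cite: Rogawski1990, §3.1 p. 19] -/
theorem exists_nhds_forall_conj_eq_imp_mem_centralizer {B : Type*} [TopologicalSpace B] {γ : ↥U}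
    (hγ : ((γ : GL n E) : Matrix n n E).charpoly.Separable) (τ : B → ↥U) {b₀ : B} (hτc : ContinuousAt τ b₀) (hτ₀ : τ b₀ = γ) :
    ∃ W ∈ 𝓝 b₀, ∀ b ∈ W, ∀ b' ∈ W, τ b ∈ Subgroup.centralizer ({γ} : Set ↥U) → τ b' ∈ Subgroup.centralizer ({γ} : Set ↥U) →
      ∀ y : ↥U, y * τ b * y⁻¹ = τ b' → y ∈ Subgroup.centralizer ({τ b} : Set ↥U) := by
  have hq : Tendsto (fun q : B × B => (((τ q.1 : ↥U) : GL n E), ((τ q.2 : ↥U) : GL n E))) (𝓝 (b₀, b₀))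
      (𝓝 ((γ : GL n E), (γ : GL n E))) := by
    have h1 : ContinuousAt (fun b : B => ((τ b : ↥U) : GL n E)) b₀ := continuous_subtype_val.continuousAt.comp hτc
    have h2 := (h1.comp continuous_fst.continuousAt).prodMk (h1.comp continuous_snd.continuousAt) (x := (b₀, b₀))
    simpa only [ContinuousAt, Function.comp_def, hτ₀, nhds_prod_eq] using h2
  have hev := hq.eventually (Literature.LinearAlgebra.Matrix.eventually_mem_centralizer_of_conj_eq (γ : GL n E) hγ)
  obtain ⟨W₁, hW₁, W₂, hW₂, hW⟩ := mem_nhds_prod_iff.1 hev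
  refine ⟨W₁ ∩ W₂, Filter.inter_mem hW₁ hW₂, fun b hb b' hb' htb htb' y hy => ?_⟩
  have key := hW (Set.mk_mem_prod hb.1 hb'.2)
  have hmem : ∀ {c : B}, τ c ∈ Subgroup.centralizer ({γ} : Set ↥U) →
      ((τ c : ↥U) : GL n E) ∈ Subgroup.centralizer ({(γ : GL n E)} : Set (GL n E)) := fun {c} h => by
    rw [Subgroup.mem_centralizer_singleton_iff] at h ⊢
    have h' := congrArg (fun g : ↥U => (g : GL n E)) h
    simpa only [Subgroup.coe_mul] using h'
  have hy' : (y : GL n E) * ((τ b : ↥U) : GL n E) * (y : GL n E)⁻¹ = ((τ b' : ↥U) : GL n E) := by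
    have h' := congrArg (fun g : ↥U => (g : GL n E)) hy
    simpa only [Subgroup.coe_mul, Subgroup.coe_inv] using h'
  have hyc := (key (hmem htb) (hmem htb') (y : GL n E) hy').2
  rw [Subgroup.mem_centralizer_singleton_iff] at hyc ⊢
  exact Subtype.ext (by simpa only [Subgroup.coe_mul] using hyc)

variable [LocallyCompactSpace ↥U] [SecondCountableTopology ↥U] [MeasurableSpace ↥U] [BorelSpace ↥U]
  [∀ g : ↥U, MeasurableSpace (↥U ⧸ Subgroup.centralizer ({g} : Set ↥U))]
  [∀ g : ↥U, BorelSpace (↥U ⧸ Subgroup.centralizer ({g} : Set ↥U))]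
  {V : Type*} [NormedAddCommGroup V] [NormedSpace ℝ V]
  {A B : Type*} [TopologicalSpace A] [TopologicalSpace B]

/-- **N6ns-reg-(ii), CLOSED-SUBGROUP FORM.** `U ≤ GL_n(E)` (locally compact, second countable), `m` a canonical family for a conjugation-invariant
`P` implied to hold at the torus points, a chart datum `(s, τ, K, B₀)` around the regular semisimple `γ = τ b₀` with torus coordinate
`τ : B₀ → Z_U(γ) ∩ {χ separable}`, the box `B₀` Weyl-separated (e.g. inside the `W` of ★ `exists_nhds_forall_conj_eq_imp_mem_centralizer`); `f` locally
constant supported in `Φ(K × B₀)`. Then `Φ([τ b], f; m) = Φ([γ], f; m)` for `b ∈ B₀` near `b₀`.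
[cite: HarishChandra1970, Part I §3] [cite: Rogawski1990, §3.1 p. 19; §4.3 p. 43; §4.9 p. 54] -/
theorem OrbitalMeasureFamily.IsCanonical.exists_nhds_classOrbitalIntegral_mk_eq_of_subgroup_chart
    {P : ↥U → Prop} (hP : ∀ g x : ↥U, P g → P (x * g * x⁻¹)) {ν : Measure ↥U} [IsHaarMeasure ν] [ν.IsMulRightInvariant]
    {m : OrbitalMeasureFamily ↥U} (hm : m.IsCanonical P ν)
    (s : A → ↥U) (hs : Continuous s) (τ : B → ↥U) (hτ : Continuous τ) {K : Set A} (hK : IsCompact K) {B₀ : Set B} {b₀ : B} (hb₀ : b₀ ∈ B₀)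
    (hγ : (((τ b₀ : ↥U) : GL n E) : Matrix n n E).charpoly.Separable)
    (hreg : ∀ b ∈ B₀, P (τ b) ∧ (((τ b : ↥U) : GL n E) : Matrix n n E).charpoly.Separable ∧ τ b ∈ Subgroup.centralizer ({τ b₀} : Set ↥U))
    (hsep : ∀ b ∈ B₀, ∀ b' ∈ B₀, ∀ y : ↥U, y * τ b * y⁻¹ = τ b' → y ∈ Subgroup.centralizer ({τ b} : Set ↥U))
    {f : ↥U → V} (hf : IsLocallyConstant f)
    (hfΩ : ∀ y, f y ≠ 0 → y ∈ (fun p : A × B => s p.1 * τ p.2 * (s p.1)⁻¹) '' (K ×ˢ B₀)) :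
    ∃ W ∈ 𝓝 b₀, ∀ b ∈ W, b ∈ B₀ →
      classOrbitalIntegral m f (ConjClasses.mk (τ b)) = classOrbitalIntegral m f (ConjClasses.mk (τ b₀)) :=
  hm.exists_nhds_classOrbitalIntegral_mk_eq_of_chart hP s hs τ hτ hK hb₀
    (fun b hb => ⟨(hreg b hb).1, centralizer_eq_centralizer_of_charpoly_separable hγ (hreg b hb).2.1 (hreg b hb).2.2⟩) hsep hf hfΩ

end Subgroup

end Literature.NumberTheory.Automorphic

end
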